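import Literature.MathematicalPhysics.AQFT.TomitaStandardSubspace
import Literature.Analysis.OperatorTheory.VonNeumannWOT
import Mathlib.Analysis.InnerProductSpace.Projection.Minimal
import Mathlib.Analysis.CStarAlgebra.ContinuousFunctionalCalculus.Order
import Mathlib.Analysis.InnerProductSpace.StarOrder
import Mathlib.Order.Filter.Ultrafilter.Basic
import HarnessLib

/-!
# Rieffel–van Daele's Lemma 4.3 (a Sakai-type Radon–Nikodym theorem)

Let `M` be a von Neumann algebra with cyclic and separating vector `Ω`, `𝒦 = closure(M_sa Ω)` and
`P` the real orthogonal projection onto `𝒦`. Rieffel–van Daele (*A bounded operator approach to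
Tomita–Takesaki theory*, Pacific J. Math. 69 (1977)):

> LEMMA 4.3. Let `x' ∈ M'_s`. Then for any `λ ∈ ℂ` with `Re(λ) > 0` there is a unique `x ∈ M_s` such
> that `⟨yω, x'ω⟩ = Re(λ⟨yω, xω⟩)` for all `y ∈ M_s`.

("whose proof is obtained by modifying the proof of Sakai's linear Radon–Nikodym theorem":
reduce to `Re λ = 1`, `0 ≤ x' ≤ 1`; the set `V = {ψ_x : x ∈ M_s, ‖x‖ ≤ 1}` is weakly compact and
convex; if `ψ ∉ V`, Hahn–Banach separation gives `h ∈ M_s` with `Re(λ⟨hω, xω⟩) < ⟨hω, x'ω⟩` for all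
`‖x‖ ≤ 1`; with the polar decomposition `h = u|h|` and `x = u` one gets
`Re(λ⟨hω,uω⟩) = ⟨|h|ω,ω⟩ ≥ ⟨|h|x'ω,ω⟩ ≥ ⟨hω,x'ω⟩`, a contradiction.)

We prove the existence statement in the equivalent Hilbert-space form
`P(x'Ω) = P(μ • xΩ)` (`μ = λ̄`, so `Re μ = Re λ`; the printed condition says exactly that
`x'Ω − λ̄xΩ ⊥_ℝ 𝒦`), replacing (i) weak compactness by weak-operator limits along an ultrafilter
(`ultraWOTLim`, which shows that `{P(μxΩ) : x ∈ M_s, ‖x‖ ≤ 1}` is norm closed), (ii) Hahn–Banach by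
the Hilbert projection theorem, and (iii) the polar decomposition `u` by the functional-calculus
approximants `u_ε = h(|h| + ε)⁻¹ ∈ M_s`.

## Main results

* `sakaiRN_core` — the case `0 ≤ x' ≤ 1`, `Re μ = 1`, with `‖x‖ ≤ 1`.
* `sakaiRN` — Lemma 4.3 (existence) for self-adjoint `x' ∈ M'` and `Re μ > 0`.

## References
* M. A. Rieffel, A. van Daele, *A bounded operator approach to Tomita–Takesaki theory*, Pacific
  J. Math. 69 (1977) 187–221, Lemma 4.3. [RieffelVandaele1977]
-/

noncomputable section

open Complex ContinuousLinearMap Filter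
open _root_.Topology
open scoped InnerProductSpace ComplexConjugate

set_option synthInstance.maxHeartbeats 200000

namespace Literature.MathematicalPhysics.AQFT

open Literature.Analysis.OperatorTheory

attribute [local instance] Literature.Analysis.OperatorTheory.realIPS

variable {H : Type*} [NormedAddCommGroup H] [InnerProductSpace ℂ H] [CompleteSpace H]
variable {M : VonNeumannAlgebra H} {Ω : H}

/-! ### Elements of `M_sa Ω` and approximation in `𝒦` -/

/-- Every element of the real span of `M_sa Ω` is of the form `h Ω` with `h ∈ M` self-adjoint.
[cite: RieffelVandaele1977, Prop. 4.1] -/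
theorem exists_of_mem_saOrbit {v : H} (hv : v ∈ saOrbit M Ω) :
    ∃ h ∈ M, IsSelfAdjoint h ∧ v = h Ω := by
  refine Submodule.span_induction (p := fun v _ => ∃ h ∈ M, IsSelfAdjoint h ∧ v = h Ω) ?_
    ⟨0, zero_mem _, IsSelfAdjoint.zero _, by simp⟩ ?_ ?_ hv
  · rintro _ ⟨A, hA, hsa, rfl⟩
    exact ⟨A, hA, hsa, rfl⟩
  · rintro x y - - ⟨h₁, h₁M, h₁sa, rfl⟩ ⟨h₂, h₂M, h₂sa, rfl⟩
    exact ⟨h₁ + h₂, add_mem h₁M h₂M, h₁sa.add h₂sa, by simp⟩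
  · rintro r x - ⟨h, hM, hsa, rfl⟩
    refine ⟨(r : ℂ) • h, M.toStarSubalgebra.smul_mem hM _, ?_, ?_⟩
    · rw [IsSelfAdjoint, star_smul, hsa.star_eq]; simp
    · rw [smul_apply, Complex.coe_smul]

/-- Vectors of `𝒦` are limits of `h Ω`, `h ∈ M_sa`. [cite: RieffelVandaele1977, Prop. 4.1] -/
theorem exists_sa_approx {η : H} (hη : η ∈ tomitaK M Ω) {ε : ℝ} (hε : 0 < ε) :
    ∃ h ∈ M, IsSelfAdjoint h ∧ ‖η - h Ω‖ < ε := by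
  have : η ∈ closure (saOrbit M Ω : Set H) := hη
  obtain ⟨v, hv, hvε⟩ := Metric.mem_closure_iff.1 this ε hε
  obtain ⟨h, hM, hsa, rfl⟩ := exists_of_mem_saOrbit hv
  exact ⟨h, hM, hsa, by rwa [← dist_eq_norm]⟩

/-! ### Functional-calculus approximants of the polar part -/

section CFC

/-- The functions `t ↦ t/(|t| + ε)`, bounded by `1`. [folklore] -/
theorem abs_div_abs_add_le {ε : ℝ} (hε : 0 < ε) (t : ℝ) : abs (t / (|t| + ε)) ≤ 1 := by
  rw [abs_div, abs_of_pos (by positivity : 0 < |t| + ε), div_le_one (by positivity)]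
  linarith [abs_nonneg t]

/-- `|t²/(|t|+ε) − |t|| ≤ ε`. [folklore] -/
theorem abs_sq_div_sub_abs_le {ε : ℝ} (hε : 0 < ε) (t : ℝ) :
    abs (t * (t / (|t| + ε)) - |t|) ≤ ε := by
  have hpos : 0 < |t| + ε := by positivity
  have : t * (t / (|t| + ε)) - |t| = -(ε * |t| / (|t| + ε)) := by
    have ht : t * t = |t| * |t| := (abs_mul_abs_self t).symm
    field_simp
    nlinarith [ht]
  rw [this, abs_neg, abs_div, abs_of_pos hpos, abs_of_nonneg (by positivity), div_le_iff₀ hpos]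
  nlinarith [abs_nonneg t]

variable {h : H →L[ℂ] H}

/-- The approximant `u_ε = h (|h| + ε)⁻¹ = cfc (t ↦ t/(|t|+ε)) h` of the polar part of `h`. [folklore] -/
def polarApprox (h : H →L[ℂ] H) (ε : ℝ) : H →L[ℂ] H := cfc (fun t : ℝ => t / (|t| + ε)) h

/-- `u_ε ∈ M`. [cite: RieffelVandaele1977, Lemma 4.3 (proof)] -/
theorem polarApprox_mem (hM : h ∈ M) (ε : ℝ) : polarApprox h ε ∈ M :=
  Literature.Analysis.OperatorTheory.VonNeumannAlgebra.cfc_real_mem M hM _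

/-- `u_ε` is self-adjoint. [folklore] -/
theorem polarApprox_isSelfAdjoint (ε : ℝ) : IsSelfAdjoint (polarApprox h ε) := by
  unfold polarApprox; exact cfc_predicate _ _

/-- `‖u_ε‖ ≤ 1`. [folklore] -/
theorem norm_polarApprox_le {ε : ℝ} (hε : 0 < ε) : ‖polarApprox h ε‖ ≤ 1 := by
  unfold polarApprox
  exact norm_cfc_le zero_le_one fun t _ => by rw [Real.norm_eq_abs]; exact abs_div_abs_add_le hε t

/-- `h u_ε = cfc (t ↦ t²/(|t|+ε)) h`. [folklore] -/
theorem mul_polarApprox (hsa : IsSelfAdjoint h) {ε : ℝ} (hε : 0 < ε) :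
    h * polarApprox h ε = cfc (fun t : ℝ => t * (t / (|t| + ε))) h := by
  unfold polarApprox
  have hc : ContinuousOn (fun t : ℝ => t / (|t| + ε)) (spectrum ℝ h) :=
    (continuousOn_id.div (by fun_prop) fun t _ => by positivity)
  nth_rw 1 [← cfc_id' ℝ h hsa]
  rw [← cfc_mul _ _ h]

/-- `0 ≤ h u_ε`. [cite: RieffelVandaele1977, Lemma 4.3 (proof)] -/
theorem mul_polarApprox_nonneg (hsa : IsSelfAdjoint h) {ε : ℝ} (hε : 0 < ε) :
    0 ≤ h * polarApprox h ε := by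
  rw [mul_polarApprox hsa hε]
  exact cfc_nonneg fun t _ => by
    have : 0 ≤ t * t / (|t| + ε) := div_nonneg (mul_self_nonneg t) (by positivity)
    simpa [mul_div_assoc] using this

/-- `‖h u_ε − |h|‖ ≤ ε`, with `|h| = cfc |·| h`. [cite: RieffelVandaele1977, Lemma 4.3 (proof)] -/
theorem norm_mul_polarApprox_sub_abs_le (hsa : IsSelfAdjoint h) {ε : ℝ} (hε : 0 < ε) :
    ‖h * polarApprox h ε - cfc (fun t : ℝ => |t|) h‖ ≤ ε := by
  have hc : ContinuousOn (fun t : ℝ => t * (t / (|t| + ε))) (spectrum ℝ h) :=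
    continuousOn_id.mul (continuousOn_id.div (by fun_prop) fun t _ => by positivity)
  rw [mul_polarApprox hsa hε, ← cfc_sub (fun t : ℝ => t * (t / (|t| + ε))) (fun t : ℝ => |t|) h hc]
  exact norm_cfc_le hε.le fun t _ => by rw [Real.norm_eq_abs]; exact abs_sq_div_sub_abs_le hε t

/-- `h ≤ |h|`. [folklore] -/
theorem le_cfc_abs (hsa : IsSelfAdjoint h) : h ≤ cfc (fun t : ℝ => |t|) h := by
  conv_lhs => rw [← cfc_id' ℝ h hsa]
  exact cfc_mono fun t _ => le_abs_self t

/-- `0 ≤ |h|`. [folklore] -/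
theorem cfc_abs_nonneg : 0 ≤ cfc (fun t : ℝ => |t|) h := cfc_nonneg fun t _ => abs_nonneg t

end CFC

/-! ### Positivity bookkeeping -/

omit [CompleteSpace H] in
/-- For a positive operator `B`, `Re ⟪ψ, B ψ⟫ ≥ 0`. [folklore] -/
theorem re_inner_nonneg_of_nonneg' {B : H →L[ℂ] H} (hB : 0 ≤ B) (ψ : H) : 0 ≤ (⟪ψ, B ψ⟫_ℂ).re := by
  have := ((ContinuousLinearMap.nonneg_iff_isPositive B).1 hB).re_inner_nonneg_right ψ
  simpa [RCLike.re_to_complex] using this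

/-- Monotonicity of diagonal matrix elements. [folklore] -/
theorem re_inner_le_of_le {B C : H →L[ℂ] H} (hBC : B ≤ C) (ψ : H) :
    (⟪ψ, B ψ⟫_ℂ).re ≤ (⟪ψ, C ψ⟫_ℂ).re := by
  have h := re_inner_nonneg_of_nonneg' (sub_nonneg.2 hBC) ψ
  rw [sub_apply, inner_sub_right, Complex.sub_re] at h
  linarith

/-- **The positivity chain of Rieffel–van Daele's proof**: for `h ∈ M_s` and `x' ∈ M'` with
`0 ≤ x' ≤ 1`, `Re ⟪Ω, h x' Ω⟫ ≤ Re ⟪Ω, |h| Ω⟫`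
("`⟨hω, x'ω⟩ = ⟨h x'^{1/2}ω, x'^{1/2}ω⟩ ≤ ⟨|h| x'^{1/2}ω, x'^{1/2}ω⟩ = ⟨|h|x'ω, ω⟩ ≤ ⟨|h|ω, ω⟩`").
[cite: RieffelVandaele1977, Lemma 4.3 (proof)] -/
theorem re_inner_mul_le_abs {h x' : H →L[ℂ] H} (hM : h ∈ M) (hsa : IsSelfAdjoint h)
    (hx'M : x' ∈ M.commutant) (hx'0 : 0 ≤ x') (hx'1 : x' ≤ 1) :
    (⟪Ω, (h * x') Ω⟫_ℂ).re ≤ (⟪Ω, cfc (fun t : ℝ => |t|) h Ω⟫_ℂ).re := by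
  set a : H →L[ℂ] H := cfc (fun t : ℝ => |t|) h with ha
  -- square roots in the commutant / in `M`
  set s : H →L[ℂ] H := cfc Real.sqrt x' with hs
  have hs_sa : IsSelfAdjoint s := by rw [hs]; exact cfc_predicate _ _
  have hss : s * s = x' := by
    rw [hs, ← cfc_mul _ _ x']
    conv_rhs => rw [← cfc_id' ℝ x' hx'0.isSelfAdjoint]
    exact cfc_congr fun t ht => Real.mul_self_sqrt (spectrum_nonneg_of_nonneg hx'0 ht)
  have hsM : s ∈ M.commutant :=
    Literature.Analysis.OperatorTheory.VonNeumannAlgebra.cfc_real_mem M.commutant hx'M _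
  set b : H →L[ℂ] H := cfc Real.sqrt a with hb
  have hb_sa : IsSelfAdjoint b := by rw [hb]; exact cfc_predicate _ _
  have ha0 : 0 ≤ a := cfc_abs_nonneg
  have hbb : b * b = a := by
    rw [hb, ← cfc_mul _ _ a]
    conv_rhs => rw [← cfc_id' ℝ a ha0.isSelfAdjoint]
    exact cfc_congr fun t ht => Real.mul_self_sqrt (spectrum_nonneg_of_nonneg ha0 ht)
  have haM : a ∈ M := Literature.Analysis.OperatorTheory.VonNeumannAlgebra.cfc_real_mem M hM _
  have hbM : b ∈ M := Literature.Analysis.OperatorTheory.VonNeumannAlgebra.cfc_real_mem M haM _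
  -- commutation relations
  have hcomm : ∀ {y z : H →L[ℂ] H}, y ∈ M → z ∈ M.commutant → y * z = z * y := fun hy hz =>
    ((VonNeumannAlgebra.mem_commutant_iff.1 hz) _ hy)
  -- step 1: `h x' ≤ |h| x'` as quadratic forms at `Ω`: `|h| x' - h x' = s (|h| - h) s`
  have h1 : (⟪Ω, (h * x') Ω⟫_ℂ).re ≤ (⟪Ω, (a * x') Ω⟫_ℂ).re := by
    have hpos : 0 ≤ a * x' - h * x' := by
      have : a * x' - h * x' = s * (a - h) * star s := by
        rw [hs_sa.star_eq, mul_sub, sub_mul, ← hcomm haM hsM, ← hcomm hM hsM, mul_assoc a s s,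
          mul_assoc h s s, hss]
      rw [this]
      exact star_right_conjugate_nonneg (sub_nonneg.2 (le_cfc_abs hsa)) s
    have := re_inner_nonneg_of_nonneg' hpos Ω
    rw [sub_apply, inner_sub_right, Complex.sub_re] at this
    linarith
  -- step 2: `|h| x' ≤ |h|`: `|h| - |h| x' = b (1 - x') b`
  have h2 : (⟪Ω, (a * x') Ω⟫_ℂ).re ≤ (⟪Ω, a Ω⟫_ℂ).re := by
    have hpos : 0 ≤ a - a * x' := by
      have : a - a * x' = b * (1 - x') * star b := by
        rw [hb_sa.star_eq, mul_sub, sub_mul, mul_one, hbb, hcomm hbM hx'M, mul_assoc, hbb,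
          hcomm haM hx'M]
      rw [this]
      exact star_right_conjugate_nonneg (sub_nonneg.2 hx'1) b
    have := re_inner_nonneg_of_nonneg' hpos Ω
    rw [sub_apply, inner_sub_right, Complex.sub_re] at this
    linarith
  exact h1.trans h2

/-! ### The convex set `S = {P(μ x Ω) : x ∈ M_s, ‖x‖ ≤ 1}` -/

section TheSet

variable (M Ω)

/-- The set `S_μ = {P(μ x Ω) : x ∈ M_s, ‖x‖ ≤ 1}` (the image of Rieffel–van Daele's `V`).
[cite: RieffelVandaele1977, Lemma 4.3 (proof)] -/
def sakaiSet (μ : ℂ) : Set H :=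
  {v : H | ∃ x ∈ M, IsSelfAdjoint x ∧ ‖x‖ ≤ 1 ∧ v = (tomitaK M Ω).starProjection (μ • x Ω)}

variable {M Ω}

/-- `S_μ` is nonempty. [folklore] -/
theorem sakaiSet_nonempty (μ : ℂ) : (sakaiSet M Ω μ).Nonempty :=
  ⟨0, 0, zero_mem _, IsSelfAdjoint.zero _, by simp, by simp⟩

/-- `S_μ` is convex. [cite: RieffelVandaele1977, Lemma 4.3 (proof: "`V` is clearly convex")] -/
theorem convex_sakaiSet (μ : ℂ) : Convex ℝ (sakaiSet M Ω μ) := by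
  rintro v ⟨x, hxM, hxsa, hxn, rfl⟩ w ⟨y, hyM, hysa, hyn, rfl⟩ a b ha hb hab
  refine ⟨(a : ℂ) • x + (b : ℂ) • y, add_mem (M.toStarSubalgebra.smul_mem hxM _)
    (M.toStarSubalgebra.smul_mem hyM _), ?_, ?_, ?_⟩
  · rw [IsSelfAdjoint, star_add, star_smul, star_smul, hxsa.star_eq, hysa.star_eq]
    simp
  · calc ‖(a : ℂ) • x + (b : ℂ) • y‖ ≤ ‖(a : ℂ) • x‖ + ‖(b : ℂ) • y‖ := norm_add_le _ _
      _ = a * ‖x‖ + b * ‖y‖ := by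
          rw [norm_smul, norm_smul, Complex.norm_real, Complex.norm_real, Real.norm_eq_abs,
            Real.norm_eq_abs, abs_of_nonneg ha, abs_of_nonneg hb]
      _ ≤ a * 1 + b * 1 := by gcongr
      _ = 1 := by rw [mul_one, mul_one, hab]
  · have e : μ • (((a : ℂ) • x + (b : ℂ) • y) Ω) = (a : ℝ) • (μ • x Ω) + (b : ℝ) • (μ • y Ω) := by
      rw [add_apply, smul_apply, smul_apply, smul_add, smul_comm μ (a : ℂ), smul_comm μ (b : ℂ),
        Complex.coe_smul, Complex.coe_smul]
    rw [e, map_add, (tomitaK M Ω).starProjection.map_smul a, (tomitaK M Ω).starProjection.map_smul b]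

/-- `S_μ` is bounded: `‖v‖ ≤ ‖μ‖ ‖Ω‖`. [folklore] -/
theorem norm_le_of_mem_sakaiSet {μ : ℂ} {v : H} (hv : v ∈ sakaiSet M Ω μ) : ‖v‖ ≤ ‖μ‖ * ‖Ω‖ := by
  obtain ⟨x, -, -, hxn, rfl⟩ := hv
  calc ‖(tomitaK M Ω).starProjection (μ • x Ω)‖ ≤ ‖μ • x Ω‖ :=
        Submodule.norm_starProjection_apply_le _ _
    _ = ‖μ‖ * ‖x Ω‖ := norm_smul _ _
    _ ≤ ‖μ‖ * (‖x‖ * ‖Ω‖) := by gcongr; exact x.le_opNorm Ω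
    _ ≤ ‖μ‖ * (1 * ‖Ω‖) := by gcongr
    _ = ‖μ‖ * ‖Ω‖ := by rw [one_mul]

/-- `S_μ ⊆ 𝒦`. [folklore] -/
theorem mem_tomitaK_of_mem_sakaiSet {μ : ℂ} {v : H} (hv : v ∈ sakaiSet M Ω μ) : v ∈ tomitaK M Ω := by
  obtain ⟨x, -, -, -, rfl⟩ := hv
  exact Submodule.starProjection_apply_mem _ _

/-- The real inner product of `η` against `P(μ x Ω)` in terms of `⟪P η, x Ω⟫`. [folklore] -/
theorem real_inner_starProjection_smul (η : H) (μ : ℂ) (x : H →L[ℂ] H) :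
    ⟪η, (tomitaK M Ω).starProjection (μ • x Ω)⟫_ℝ = (μ * ⟪(tomitaK M Ω).starProjection η, x Ω⟫_ℂ).re := by
  rw [← Submodule.inner_starProjection_left_eq_right, real_inner_eq_re, inner_smul_right]

/-- **`S_μ` is norm closed** (weak-operator limits along an ultrafilter stay in the unit ball of
`M_s`; replaces "`V` is weakly compact"). [cite: RieffelVandaele1977, Lemma 4.3 (proof)] -/
theorem isClosed_sakaiSet (μ : ℂ) : IsClosed (sakaiSet M Ω μ) := by
  refine isClosed_of_closure_subset fun v hv => ?_
  obtain ⟨vseq, hvS, hvlim⟩ := mem_closure_iff_seq_limit.1 hv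
  choose x hxM hxsa hxn hxeq using hvS
  -- the WOT limit along the hyperfilter
  set 𝒰 : Ultrafilter ℕ := hyperfilter ℕ
  set T : H →L[ℂ] H := ultraWOTLim 𝒰 x 1 hxn with hT
  refine ⟨T, ultraWOTLim_mem 𝒰 x 1 hxn M hxM, ultraWOTLim_isSelfAdjoint 𝒰 x 1 hxn hxsa,
    norm_ultraWOTLim_le 𝒰 x 1 hxn, ?_⟩
  -- `v = P(μ T Ω)`: test against every `η` for the real inner product
  refine ext_inner_left ℝ fun η => ?_
  rw [real_inner_starProjection_smul]
  have h1 : Tendsto (fun n => ⟪η, vseq n⟫_ℝ) 𝒰 (𝓝 ⟪η, v⟫_ℝ) :=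
    (((continuous_const.inner continuous_id).tendsto v).comp hvlim).mono_left Nat.hyperfilter_le_atTop
  have h2 : Tendsto (fun n => ⟪η, vseq n⟫_ℝ) 𝒰
      (𝓝 ((μ * ⟪(tomitaK M Ω).starProjection η, T Ω⟫_ℂ).re)) := by
    have hform : (fun n => ⟪η, vseq n⟫_ℝ) =
        fun n => (μ * ⟪(tomitaK M Ω).starProjection η, x n Ω⟫_ℂ).re := by
      ext n; rw [hxeq n, real_inner_starProjection_smul]
    rw [hform]
    have hlim := tendsto_inner_ultraWOTLim 𝒰 x 1 hxn ((tomitaK M Ω).starProjection η) Ω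
    exact (Complex.continuous_re.tendsto _).comp ((hlim.const_mul μ))
  exact tendsto_nhds_unique h1 h2

/-- `S_μ` is complete. [folklore] -/
theorem isComplete_sakaiSet (μ : ℂ) : IsComplete (sakaiSet M Ω μ) := (isClosed_sakaiSet μ).isComplete

end TheSet

/-! ### The core case `0 ≤ x' ≤ 1`, `Re μ = 1` -/

/-- `P (i Ω) = 0` (`Ω ⊥_ℝ i𝒦` means `i Ω ⊥_ℝ 𝒦`). [cite: RieffelVandaele1977, Lemma 4.9 (proof)] -/
theorem starProjection_I_smul_self : (tomitaK M Ω).starProjection ((I : ℂ) • Ω) = 0 := by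
  rw [starProjection_I_smul, starProjection_mulI_tomitaK_self, smul_zero]

/-- For real `⟪P η, w⟫`-pairings: `⟪η, u⟫_ℝ = ⟪P η, u⟫_ℝ` when `u ∈ 𝒦`. [folklore] -/
theorem real_inner_eq_starProjection_inner {η u : H} (hu : u ∈ tomitaK M Ω) :
    ⟪η, u⟫_ℝ = ⟪(tomitaK M Ω).starProjection η, u⟫_ℝ := by
  rw [Submodule.inner_starProjection_left_eq_right, Submodule.starProjection_eq_self_iff.2 hu]

/-- **Lemma 4.3, core case** (`0 ≤ x' ≤ 1` in `M'`, `Re μ = 1`): there is `x ∈ M_s` with `‖x‖ ≤ 1`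
and `P(x'Ω) = P(μ x Ω)`. [cite: RieffelVandaele1977, Lemma 4.3] -/
theorem sakaiRN_core {x' : H →L[ℂ] H} (hx'M : x' ∈ M.commutant)
    (hx'0 : 0 ≤ x') (hx'1 : x' ≤ 1) {μ : ℂ} (hμ : μ.re = 1) :
    ∃ x ∈ M, IsSelfAdjoint x ∧ ‖x‖ ≤ 1 ∧
      (tomitaK M Ω).starProjection (x' Ω) = (tomitaK M Ω).starProjection (μ • x Ω) := by
  set K := tomitaK M Ω with hK
  set S := sakaiSet M Ω μ with hS
  set u : H := K.starProjection (x' Ω) with hu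
  by_contra hcon
  have huS : u ∉ S := fun ⟨x, hxM, hxsa, hxn, hxeq⟩ => hcon ⟨x, hxM, hxsa, hxn, hxeq⟩
  -- Hilbert projection onto the closed convex set `S`
  obtain ⟨p, hpS, hp⟩ := exists_norm_eq_iInf_of_complete_convex (sakaiSet_nonempty μ)
    (isComplete_sakaiSet μ) (convex_sakaiSet μ) u
  have hchar := (norm_eq_iInf_iff_real_inner_le_zero (convex_sakaiSet μ) hpS).1 hp
  set η : H := u - p with hη
  have hη0 : η ≠ 0 := fun h => huS (by rw [sub_eq_zero.1 h]; exact hpS)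
  have hδ : 0 < ‖η‖ ^ 2 := by positivity
  -- strict separation: `⟪η, w⟫_ℝ ≤ ⟪η, u⟫_ℝ - ‖η‖²` on `S`
  have hsep : ∀ w ∈ S, ⟪η, w⟫_ℝ ≤ ⟪η, u⟫_ℝ - ‖η‖ ^ 2 := by
    intro w hw
    have h1 := hchar w hw
    have h2 : ⟪η, u⟫_ℝ - ‖η‖ ^ 2 = ⟪η, p⟫_ℝ := by
      rw [hη, ← real_inner_self_eq_norm_sq, inner_sub_right]
      ring
    rw [h2]
    have : ⟪u - p, w - p⟫_ℝ = ⟪η, w⟫_ℝ - ⟪η, p⟫_ℝ := by rw [hη, inner_sub_right]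
    linarith
  -- replace `η` by `P η ∈ K` (all of `S` and `u` lie in `K`)
  set η' : H := K.starProjection η with hη'
  have huK : u ∈ K := Submodule.starProjection_apply_mem _ _
  have hsep' : ∀ w ∈ S, ⟪η', w⟫_ℝ ≤ ⟪η', u⟫_ℝ - ‖η‖ ^ 2 := by
    intro w hw
    rw [hη', ← real_inner_eq_starProjection_inner (mem_tomitaK_of_mem_sakaiSet hw),
      ← real_inner_eq_starProjection_inner huK]
    exact hsep w hw
  -- approximate `η'` by `h Ω`, `h ∈ M_s`
  set C : ℝ := ‖μ‖ * ‖Ω‖ + ‖u‖ + 1 with hC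
  have hCpos : 0 < C := by positivity
  obtain ⟨h, hM, hsa, hhε⟩ := exists_sa_approx (Submodule.starProjection_apply_mem K η)
    (ε := ‖η‖ ^ 2 / (4 * C)) (by positivity)
  -- the separation with `h Ω`: `⟪hΩ, w⟫_ℝ ≤ ⟪hΩ, u⟫_ℝ - ‖η‖²/2`
  have hsepH : ∀ w ∈ S, ⟪h Ω, w⟫_ℝ ≤ ⟪h Ω, u⟫_ℝ - ‖η‖ ^ 2 / 2 := by
    intro w hw
    have e1 : |⟪η', w⟫_ℝ - ⟪h Ω, w⟫_ℝ| ≤ ‖η‖ ^ 2 / (4 * C) * (‖μ‖ * ‖Ω‖) := by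
      rw [← inner_sub_left]
      refine (abs_real_inner_le_norm _ _).trans ?_
      exact mul_le_mul hhε.le (norm_le_of_mem_sakaiSet hw) (norm_nonneg _) (by positivity)
    have e2 : |⟪η', u⟫_ℝ - ⟪h Ω, u⟫_ℝ| ≤ ‖η‖ ^ 2 / (4 * C) * ‖u‖ := by
      rw [← inner_sub_left]
      refine (abs_real_inner_le_norm _ _).trans ?_
      exact mul_le_mul_of_nonneg_right hhε.le (norm_nonneg _)
    have e3 : ‖η‖ ^ 2 / (4 * C) * (‖μ‖ * ‖Ω‖) + ‖η‖ ^ 2 / (4 * C) * ‖u‖ ≤ ‖η‖ ^ 2 / 2 := by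
      rw [← mul_add]
      have h2C : ‖μ‖ * ‖Ω‖ + ‖u‖ ≤ 2 * C := by
        rw [hC]; nlinarith [norm_nonneg μ, norm_nonneg Ω, norm_nonneg u,
          mul_nonneg (norm_nonneg μ) (norm_nonneg Ω)]
      have hq : 0 ≤ ‖η‖ ^ 2 / (4 * C) := by positivity
      calc ‖η‖ ^ 2 / (4 * C) * (‖μ‖ * ‖Ω‖ + ‖u‖) ≤ ‖η‖ ^ 2 / (4 * C) * (2 * C) :=
            mul_le_mul_of_nonneg_left h2C hq
        _ = ‖η‖ ^ 2 / 2 := by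
            field_simp
            ring
    have := hsep' w hw
    have a1 := (abs_le.1 e1)
    have a2 := (abs_le.1 e2)
    linarith [a1.1, a1.2, a2.1, a2.2]
  -- evaluate at `w_ε = P(μ u_ε Ω)`
  have hΩ : 0 < ‖Ω‖ := by
    rw [norm_pos_iff]; intro h0
    apply hη0
    -- `Ω = 0`: everything vanishes
    have hx0 : x' Ω = 0 := by rw [h0, map_zero]
    have : u = 0 := by rw [hu, hx0, map_zero]
    have hp0 : p = 0 := by
      obtain ⟨x, -, -, -, rfl⟩ := hpS
      have hx0' : x Ω = 0 := by rw [h0, map_zero]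
      rw [hx0', smul_zero, map_zero]
    rw [hη, this, hp0, sub_zero]
  obtain ⟨ε, hε, hεsmall⟩ : ∃ ε : ℝ, 0 < ε ∧ ε * ‖Ω‖ ^ 2 < ‖η‖ ^ 2 / 2 := by
    refine ⟨‖η‖ ^ 2 / (4 * ‖Ω‖ ^ 2), by positivity, ?_⟩
    have hΩ2 : 0 < ‖Ω‖ ^ 2 := by positivity
    rw [show ‖η‖ ^ 2 / (4 * ‖Ω‖ ^ 2) * ‖Ω‖ ^ 2 = ‖η‖ ^ 2 / 4 by field_simp]
    linarith
  set uε := polarApprox h ε with huε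
  have hwS : K.starProjection (μ • uε Ω) ∈ S :=
    ⟨uε, polarApprox_mem hM ε, polarApprox_isSelfAdjoint ε, norm_polarApprox_le hε, rfl⟩
  have hineq := hsepH _ hwS
  -- left side: `⟪hΩ, P(μ u_ε Ω)⟫_ℝ = Re ⟪Ω, h u_ε Ω⟫ ≥ Re ⟪Ω, |h| Ω⟫ - ε ‖Ω‖²`
  have hsym := ContinuousLinearMap.isSelfAdjoint_iff_isSymmetric.1 hsa
  have hL : ⟪h Ω, K.starProjection (μ • uε Ω)⟫_ℝ = (⟪Ω, (h * uε) Ω⟫_ℂ).re := by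
    rw [real_inner_starProjection_smul, starProjection_apply_mem hM hsa]
    have hreal : ⟪h Ω, uε Ω⟫_ℂ = ((⟪Ω, (h * uε) Ω⟫_ℂ).re : ℂ) := by
      have e : ⟪h Ω, uε Ω⟫_ℂ = ⟪Ω, (h * uε) Ω⟫_ℂ := by
        rw [mul_apply_eq_comp]; simpa only [ContinuousLinearMap.coe_coe] using hsym Ω (uε Ω)
      rw [e]
      -- `⟪Ω, (h u_ε) Ω⟫` is real (positive operator)
      have hpos := (ContinuousLinearMap.nonneg_iff_isPositive _).1 (mul_polarApprox_nonneg hsa hε)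
      have hs := ContinuousLinearMap.isSelfAdjoint_iff_isSymmetric.1 hpos.isSelfAdjoint
      have hc : conj ⟪Ω, (h * uε) Ω⟫_ℂ = ⟪Ω, (h * uε) Ω⟫_ℂ := by
        rw [inner_conj_symm]; simpa only [ContinuousLinearMap.coe_coe] using hs Ω Ω
      exact (Complex.conj_eq_iff_re.1 hc).symm
    rw [hreal]
    simp only [Complex.mul_re, Complex.ofReal_re, Complex.ofReal_im, mul_zero, sub_zero, hμ, one_mul]
  have hL2 : (⟪Ω, cfc (fun t : ℝ => |t|) h Ω⟫_ℂ).re - ε * ‖Ω‖ ^ 2 ≤ (⟪Ω, (h * uε) Ω⟫_ℂ).re := by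
    have hb := norm_mul_polarApprox_sub_abs_le hsa hε
    have : |(⟪Ω, (h * uε) Ω⟫_ℂ).re - (⟪Ω, cfc (fun t : ℝ => |t|) h Ω⟫_ℂ).re| ≤ ε * ‖Ω‖ ^ 2 := by
      rw [← Complex.sub_re, ← inner_sub_right, ← sub_apply]
      refine (Complex.abs_re_le_norm _).trans ((norm_inner_le_norm _ _).trans ?_)
      calc ‖Ω‖ * ‖(h * uε - cfc (fun t : ℝ => |t|) h) Ω‖ ≤ ‖Ω‖ * (ε * ‖Ω‖) := by
            gcongr; exact (le_opNorm _ _).trans (by gcongr)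
        _ = ε * ‖Ω‖ ^ 2 := by ring
    have := (abs_le.1 this).1
    linarith
  -- right side: `⟪hΩ, u⟫_ℝ = Re ⟪Ω, h x' Ω⟫ ≤ Re ⟪Ω, |h| Ω⟫`
  have hR : ⟪h Ω, u⟫_ℝ ≤ (⟪Ω, cfc (fun t : ℝ => |t|) h Ω⟫_ℂ).re := by
    rw [hu, ← Submodule.inner_starProjection_left_eq_right, starProjection_apply_mem hM hsa,
      real_inner_eq_re]
    have e : ⟪h Ω, x' Ω⟫_ℂ = ⟪Ω, (h * x') Ω⟫_ℂ := by
      rw [mul_apply_eq_comp]; simpa only [ContinuousLinearMap.coe_coe] using hsym Ω (x' Ω)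
    rw [e]
    exact re_inner_mul_le_abs hM hsa hx'M hx'0 hx'1
  rw [hL] at hineq
  linarith

/-! ### Reductions: general self-adjoint `x'` and `Re μ > 0` -/

/-- `P(μ Ω) = Ω` when `Re μ = 1` (`P Ω = Ω`, `P(iΩ) = 0`). [cite: RieffelVandaele1977, Lemma 4.9 (proof)] -/
theorem starProjection_smul_self {μ : ℂ} (hμ : μ.re = 1) :
    (tomitaK M Ω).starProjection (μ • Ω) = Ω := by
  have hdec : μ • Ω = Ω + μ.im • ((I : ℂ) • Ω) := by
    conv_lhs => rw [← re_add_im μ, hμ, Complex.ofReal_one]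
    rw [add_smul, one_smul, mul_smul, Complex.coe_smul]
  rw [hdec, map_add, map_smul, starProjection_I_smul_self, smul_zero, add_zero,
    starProjection_tomitaK_self]

/-- A self-adjoint operator lies between `-‖x'‖` and `‖x'‖`. [folklore] -/
theorem le_norm_algebraMap {x' : H →L[ℂ] H} (hsa : IsSelfAdjoint x') :
    x' ≤ algebraMap ℝ (H →L[ℂ] H) ‖x'‖ :=
  (le_algebraMap_iff_spectrum_le hsa).2 fun _ ht => (spectrum_real_subset_Icc x' ht).2

/-- A self-adjoint operator lies between `-‖x'‖` and `‖x'‖`. [folklore] -/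
theorem neg_norm_algebraMap_le {x' : H →L[ℂ] H} (hsa : IsSelfAdjoint x') :
    algebraMap ℝ (H →L[ℂ] H) (-‖x'‖) ≤ x' :=
  (algebraMap_le_iff_le_spectrum hsa).2 fun _ ht => (spectrum_real_subset_Icc x' ht).1

/-- **Lemma 4.3 for `Re μ = 1`** and any self-adjoint `x' ∈ M'` ("by real linearity we may assume
… `0 ≤ x' ≤ 1`"). [cite: RieffelVandaele1977, Lemma 4.3] -/
theorem sakaiRN_re_one {x' : H →L[ℂ] H} (hx'M : x' ∈ M.commutant) (hsa' : IsSelfAdjoint x')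
    {μ : ℂ} (hμ : μ.re = 1) :
    ∃ x ∈ M, IsSelfAdjoint x ∧
      (tomitaK M Ω).starProjection (x' Ω) = (tomitaK M Ω).starProjection (μ • x Ω) := by
  set K := tomitaK M Ω
  -- `x'' = (x' + c)/(2c)` with `c = ‖x'‖ + 1` satisfies `0 ≤ x'' ≤ 1`
  set c : ℝ := ‖x'‖ + 1 with hc
  have hcpos : 0 < c := by positivity
  set x'' : H →L[ℂ] H := ((2 * c)⁻¹ : ℝ) • (x' + algebraMap ℝ (H →L[ℂ] H) c) with hx''
  have hx''M : x'' ∈ M.commutant := by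
    refine M.commutant.toStarSubalgebra.smul_mem (add_mem hx'M ?_) _
    rw [Algebra.algebraMap_eq_smul_one]
    exact M.commutant.toStarSubalgebra.smul_mem (one_mem _) _
  have h0 : 0 ≤ x' + algebraMap ℝ (H →L[ℂ] H) c := by
    have h : algebraMap ℝ (H →L[ℂ] H) (-c) ≤ x' :=
      (algebraMap_le_iff_le_spectrum (R := ℝ) (A := H →L[ℂ] H) (a := x') (r := -c) hsa').2
        fun _ ht => by linarith [(spectrum_real_subset_Icc x' ht).1, norm_nonneg x']
    have := sub_nonneg.2 h
    rwa [map_neg, sub_neg_eq_add] at this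
  have h1 : x' + algebraMap ℝ (H →L[ℂ] H) c ≤ algebraMap ℝ (H →L[ℂ] H) (2 * c) := by
    have h : x' ≤ algebraMap ℝ (H →L[ℂ] H) c :=
      (le_algebraMap_iff_spectrum_le (R := ℝ) (A := H →L[ℂ] H) (a := x') (r := c) hsa').2
        fun _ ht => by linarith [(spectrum_real_subset_Icc x' ht).2]
    calc x' + algebraMap ℝ (H →L[ℂ] H) c ≤ algebraMap ℝ _ c + algebraMap ℝ _ c := add_le_add h le_rfl
      _ = algebraMap ℝ _ (2 * c) := by rw [← map_add, two_mul]
  have hx''0 : 0 ≤ x'' := by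
    rw [hx'']
    exact smul_nonneg (by positivity) h0
  have hx''1 : x'' ≤ 1 := by
    rw [hx'']
    calc ((2 * c)⁻¹ : ℝ) • (x' + algebraMap ℝ (H →L[ℂ] H) c)
        ≤ ((2 * c)⁻¹ : ℝ) • algebraMap ℝ (H →L[ℂ] H) (2 * c) := smul_le_smul_of_nonneg_left h1 (by positivity)
      _ = 1 := by
          rw [Algebra.algebraMap_eq_smul_one, smul_smul, inv_mul_cancel₀ (by positivity), one_smul]
  obtain ⟨x₁, hx₁M, hx₁sa, -, hx₁⟩ := sakaiRN_core (M := M) (Ω := Ω) hx''M hx''0 hx''1 hμ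
  have hx''Ω : x'' Ω = ((2 * c)⁻¹ : ℝ) • (x' Ω + (c : ℝ) • Ω) := by
    rw [hx'', smul_apply, add_apply, Algebra.algebraMap_eq_smul_one, smul_apply, one_apply_eq_self]
  clear_value x''
  -- `x' = 2c x'' - c`, so take `x = 2c x₁ - c`
  refine ⟨((2 * c : ℝ) : ℂ) • x₁ - algebraMap ℝ (H →L[ℂ] H) c, sub_mem (M.toStarSubalgebra.smul_mem hx₁M _)
    (by rw [Algebra.algebraMap_eq_smul_one]; exact M.toStarSubalgebra.smul_mem (one_mem _) _), ?_, ?_⟩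
  · rw [IsSelfAdjoint, star_sub, star_smul, hx₁sa.star_eq, Algebra.algebraMap_eq_smul_one, star_smul,
      star_one]
    simp
  · have hx'eq : x' Ω = (2 * c : ℝ) • x'' Ω - (c : ℝ) • Ω := by
      rw [hx''Ω, smul_smul, mul_inv_cancel₀ (by positivity : (2 * c : ℝ) ≠ 0), one_smul,
        add_sub_cancel_right]
    have hxeq : μ • ((((2 * c : ℝ) : ℂ) • x₁ - algebraMap ℝ (H →L[ℂ] H) c) Ω) =
        (2 * c : ℝ) • (μ • x₁ Ω) - (c : ℝ) • (μ • Ω) := by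
      rw [sub_apply, smul_apply, Algebra.algebraMap_eq_smul_one, smul_apply, one_apply_eq_self, smul_sub,
        smul_comm μ ((2 * c : ℝ) : ℂ), Complex.coe_smul, smul_comm μ c]
    rw [hx'eq, hxeq, map_sub, map_sub, K.starProjection.map_smul, K.starProjection.map_smul,
      K.starProjection.map_smul, K.starProjection.map_smul, hx₁, starProjection_smul_self hμ,
      starProjection_tomitaK_self]

/-- **Rieffel–van Daele, Lemma 4.3** (existence): for self-adjoint `x' ∈ M'` and `Re μ > 0` there is
a self-adjoint `x ∈ M` with `P(x'Ω) = P(μ xΩ)`, i.e. `⟨yΩ, x'Ω⟩ = Re(μ̄ ⟨yΩ, xΩ⟩)` for all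
`y ∈ M_s`. [cite: RieffelVandaele1977, Lemma 4.3] -/
theorem sakaiRN {x' : H →L[ℂ] H} (hx'M : x' ∈ M.commutant) (hsa' : IsSelfAdjoint x') {μ : ℂ}
    (hμ : 0 < μ.re) :
    ∃ x ∈ M, IsSelfAdjoint x ∧
      (tomitaK M Ω).starProjection (x' Ω) = (tomitaK M Ω).starProjection (μ • x Ω) := by
  -- normalise `Re μ = 1`
  set μ₁ : ℂ := ((μ.re)⁻¹ : ℝ) • μ with hμ₁
  have hμ₁re : μ₁.re = 1 := by
    rw [hμ₁, Complex.real_smul, Complex.mul_re, Complex.ofReal_re, Complex.ofReal_im, zero_mul,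
      sub_zero, inv_mul_cancel₀ hμ.ne']
  obtain ⟨x₁, hx₁M, hx₁sa, hx₁⟩ := sakaiRN_re_one (M := M) (Ω := Ω) hx'M hsa' hμ₁re
  refine ⟨((μ.re)⁻¹ : ℝ) • x₁, M.toStarSubalgebra.smul_mem hx₁M _, ?_, ?_⟩
  · change IsSelfAdjoint ((((μ.re)⁻¹ : ℝ) : ℂ) • x₁)
    rw [IsSelfAdjoint, star_smul, hx₁sa.star_eq]; simp
  · rw [hx₁, hμ₁, smul_apply, smul_comm, smul_assoc]

/-! ### Corollary 4.4 -/

/-- **Rieffel–van Daele, Corollary 4.4, self-adjoint case**: for self-adjoint `x' ∈ M'` there is a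
self-adjoint `x ∈ M` with `(P − Q) x'Ω = xΩ` ("`xω` is the orthogonal projection of `x'ω` onto `𝒦`,
`Px'ω = xω`; `Qx'ω = 0`; thus `JTx'ω = (P − Q)x'ω = xω`"). [cite: RieffelVandaele1977, Cor. 4.4] -/
theorem exists_modB_apply_eq_of_isSelfAdjoint {x' : H →L[ℂ] H} (hx'M : x' ∈ M.commutant)
    (hsa' : IsSelfAdjoint x') :
    ∃ x ∈ M, IsSelfAdjoint x ∧ modB (tomitaK M Ω) (x' Ω) = x Ω := by
  obtain ⟨x, hxM, hxsa, hx⟩ := sakaiRN (M := M) (Ω := Ω) hx'M hsa' (μ := 1) (by simp)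
  refine ⟨x, hxM, hxsa, ?_⟩
  rw [modB_apply, hx, one_smul, starProjection_apply_mem hxM hxsa,
    starProjection_mulI_apply_commutant hx'M hsa', sub_zero]

/-- **Rieffel–van Daele, Corollary 4.4**: for any `x' ∈ M'` there is `x ∈ M` with
`JTx'Ω = xΩ` and `JTx'*Ω = x*Ω` (here `JT = P − Q = modB`). [cite: RieffelVandaele1977, Cor. 4.4] -/
theorem exists_modB_apply_eq {x' : H →L[ℂ] H} (hx'M : x' ∈ M.commutant) :
    ∃ x ∈ M, modB (tomitaK M Ω) (x' Ω) = x Ω ∧ modB (tomitaK M Ω) ((star x') Ω) = (star x) Ω := by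
  set K := tomitaK M Ω
  -- decompose `x' = a' + i b'`
  set a' : H →L[ℂ] H := (2⁻¹ : ℂ) • (x' + star x') with ha'
  set b' : H →L[ℂ] H := (-(2⁻¹ : ℂ) * I) • (x' - star x') with hb'
  have ha'M : a' ∈ M.commutant := M.commutant.toStarSubalgebra.smul_mem (add_mem hx'M (star_mem hx'M)) _
  have hb'M : b' ∈ M.commutant := M.commutant.toStarSubalgebra.smul_mem (sub_mem hx'M (star_mem hx'M)) _
  have ha'sa : IsSelfAdjoint a' := by
    rw [ha', IsSelfAdjoint, star_smul, star_add, star_star, add_comm]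
    congr 1
    simp
  have hb'sa : IsSelfAdjoint b' := by
    rw [hb', IsSelfAdjoint, star_smul, star_sub, star_star]
    rw [show star (-(2⁻¹ : ℂ) * I) = (2⁻¹ : ℂ) * I by simp, ← neg_sub x', smul_neg, ← neg_smul]
    congr 1
    ring
  have hx'dec : x' = a' + I • b' := by
    rw [ha', hb', smul_smul, show I * (-(2⁻¹ : ℂ) * I) = 2⁻¹ by
      rw [mul_comm, mul_assoc, I_mul_I]; ring, smul_add, smul_sub, add_add_sub_cancel, ← add_smul]
    norm_num
  clear_value a' b'
  have hx'dec' : star x' = a' - I • b' := by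
    have h := congrArg star hx'dec
    rw [star_add, ha'sa.star_eq, star_smul, hb'sa.star_eq, Complex.star_def, Complex.conj_I, neg_smul,
      ← sub_eq_add_neg] at h
    exact h
  obtain ⟨a, haM, hasa, ha⟩ := exists_modB_apply_eq_of_isSelfAdjoint (M := M) (Ω := Ω) ha'M ha'sa
  obtain ⟨b, hbM, hbsa, hb⟩ := exists_modB_apply_eq_of_isSelfAdjoint (M := M) (Ω := Ω) hb'M hb'sa
  refine ⟨a - I • b, sub_mem haM (M.toStarSubalgebra.smul_mem hbM _), ?_, ?_⟩
  · rw [hx'dec, add_apply, smul_apply, map_add, modB_smul, ha, hb, Complex.conj_I, neg_smul,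
      sub_apply, smul_apply, sub_eq_add_neg]
  · rw [hx'dec', sub_apply, smul_apply, map_sub, modB_smul, ha, hb, Complex.conj_I, neg_smul,
      sub_neg_eq_add, star_sub, star_smul, hasa.star_eq, hbsa.star_eq, Complex.star_def,
      Complex.conj_I, neg_smul, sub_neg_eq_add, add_apply, smul_apply]

end Literature.MathematicalPhysics.AQFT
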